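import Literature.NumberTheory.EllipticCurves.HeegnerHypothesisKroneckerProofs
import HarnessLib
import HarnessLib.Audit.Tags

/-!
# Heegner hypotheses of the KL3 rows of record, DERIVED in the kernel from `d_K` alone
# (decomposition law + Jacobi symbols by `norm_num`) — part 35h (o5-r2 GEN 35; = the GEN 34 "edit 3" lemmas of parts 34a–34e
# gathered in ONE dependency-free module)

HONEST FRAMING (cell `b2b-bsdres`, run/shared/lean/b2b/bsd-rank1-residual/, verbatim in every file): the
goal of the cell is to DELETE the COMBINATION-SHAPED residual classes of the Birch–Swinnerton-Dyer
formula for ALL analytic-rank `≤ 1` elliptic curves over `ℚ` — "full BSD formula for every rank `≤ 1`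
curve in class `C`" assembled STRICTLY from published theorems — so that the rank-`≤ 1` remainder
becomes exactly the CONSTRUCTION-SHAPED classes, which are TYPED (missing-input `Prop`s), NOT
attempted. This is not "finishing BSD". Seat o5-r2 (planner 2, non-Iwasawa side) works a RESEARCH ROUTE
on O5 = (t′); **O5 stays OPEN**; no claim beyond the stated rows; every theorem is CONDITIONAL on its
displayed binders; census / instrument statements are EVIDENCE or displayed binders, never a Literature
fact; NOTHING is booked and no mark / label / count / tier of `RESIDUAL-MAP.md` moves.

WHAT IS HERE (0 defs, 0 named facts, 0 sorry; imports ONLY the BUILT Literature module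
`HeegnerHypothesisKroneckerProofs` — placeable and farm-checkable today, independent of part 32 and of every row file):
`satisfiesHeegnerHypothesis_listProd_of_kronecker` — the Heegner hypothesis for a level written as a product of listed primes,
from the decomposition law in the quadratic field `K` (`satisfiesHeegnerHypothesis_iff_kronecker`, tree, PROVED: for `[K:ℚ] = 2`
and a prime `p`, `p` splits ⟺ (`p = 2 → d_K % 8 = 1`) ∧ (`p ≠ 2 → jacobiSym d_K p = 1`); `satisfiesHeegnerHypothesis_mul_iff`,
`satisfiesHeegnerHypothesis_one`) by induction on the list; and the six level lemmas `satisfiesHeegnerHypothesis_<N>_of_discr`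
for the (level, `d_K`) pairs of the seven rows of record — (240930, −551), (149895, −356), (430425, −344), (439569, −263),
(23184, −551), (162288, −551) — whose side conditions (`(d_K/p) = +1` for each listed prime, `d_K ≡ 1 (mod 8)` at `p = 2`)
`norm_num` decides (Mathlib's Jacobi-symbol extension). Each row file (parts 35a–35e) imports this module and DERIVES its former
displayed binders `hH : SatisfiesHeegnerHypothesis N K`, `hH' : SatisfiesHeegnerHypothesis N' K`, `h3K : SatisfiesHeegnerHypothesis 3 K`
by Carayol's level theorem (`N = N_W`, `N' = N_G` from `hmod`) and `SatisfiesHeegnerHypothesis.of_dvd` (`N_G ∣ N_W`, `3 ∣ N_W`).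
Data: 240930 = 2·3²·5·2677 ⊇ 26770 = 2·5·2677 (d = −551); 149895 = 3²·5·3331 ⊇ 16655 = 5·3331 (d = −356); 430425 = 3²·5²·1913 ⊇
47825 = 5²·1913 (d = −344); 439569 = 3²·13²·17² ⊇ 48841 = 13²·17² (d = −263); 23184 = 2⁴·3²·7·23, 162288 = 2⁴·3²·7²·23 ⊇ 2576 = 2⁴·7·23
(d = −551).
GEN 34 → GEN 35: the seven theorems are the GEN 34 blocks BYTE FOR BYTE (34a §1: the list lemma + `…_240930_of_discr`; 34b / 34c / 34d / 34e
§2: the other five; one docstring clause of the list lemma re-pointed), only MOVED here so that (i) the module is checkable now and (ii) no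
row file imports another row file for a lemma (34b–34e imported 34a). Checked: `gen34/scratch/heegner_hyp_scratch.lean` (rc 0, 0 warnings)
and this whole file (`gen35/scratch/CHECKS.md`).

References: [Marcus1977] D. A. Marcus, Number Fields, Springer 1977, Ch. 3 Thm. 25 (decomposition of primes in quadratic fields);
[Darmon2004] H. Darmon, Rational Points on Modular Elliptic Curves, CBMS 101 (2004), Hypothesis 3.9 (the Heegner hypothesis);
[GrossZagier1986] §I.

### cc-typer-5 GEN 20 (O5 §3.5 / O6 §3.4 typer of record) — by-name ask A-O5-G35-1 (h) of o5-r2 GEN 35 (HOME/INBOX.md l.16133; by sha, VERBATIM + ¶; memo gen35/O5-GEN35.md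
§G35-6): 7b029eb2d611a4f8 → O5/HeegnerHypothesisOfDiscr.lean (placeable now). Source: `HOME/b2b-bsdres-o5-r2/gen35/lean/HeegnerHypothesisOfDiscr.lean` sha16 `7b029eb2d611a4f8`
(148 l.; `gen35/SHA16.txt`; o5-r2's farm checks rc 0 / 0 warnings / 0 sorries, axioms standard, dedup clean as stated in their line), re-hashed by the typer right before writing;
THIS file = the source VERBATIM + this paragraph (imports, module text, every declaration block byte-identical; script `class-closure/typer-5/gen20/gplace.py`, docstring anchor
asserted); imports `Literature.NumberTheory.EllipticCurves.HeegnerHypothesisKroneckerProofs` — all in the tree at filing; the typer's own standalone farm check on tree imports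
(rc 0 / 0 warnings / 0 sorries; `#print axioms` of the END(s) standard) and DEDUP (`lean search --decl` on the 7 new names: no match; the gate's statement-level dedup at dry-run)
precede the proposal. CONTENT LABELS: as the source's module text above states (declarations: `satisfiesHeegnerHypothesis_listProd_of_kronecker`,
`satisfiesHeegnerHypothesis_240930_of_discr`, `satisfiesHeegnerHypothesis_149895_of_discr`, `satisfiesHeegnerHypothesis_430425_of_discr`,
`satisfiesHeegnerHypothesis_439569_of_discr`, `satisfiesHeegnerHypothesis_23184_of_discr`, `satisfiesHeegnerHypothesis_162288_of_discr`); 0 `@[conjecture]`, 0 Literature facts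
(net named-fact debt 0), no `sorry`; published inputs stay displayed hypotheses BY NAME, nothing re-proved. HONEST FRAMING (cell `b2b-bsdres`): research route, lane CLASS-CLOSURE
§3.5 O5; CONDITIONAL ENDs — nothing asserted beyond the displayed binders, nothing booked, no mark / label / count / tier of `RESIDUAL-MAP.md` moves; census / instrument
statements = EVIDENCE or displayed binders, never a Literature fact; O5 OPEN.
-/

set_option autoImplicit false

open Literature.NumberTheory.EllipticCurves

namespace Summit.BirchSwinnertonDyer.Rank1Residual.O5.HeegnerLogTransport

/-- **Heegner hypothesis for a level written as a product of listed primes**, from the decomposition law in the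
quadratic field `K` (`satisfiesHeegnerHypothesis_iff_kronecker`; Marcus, *Number Fields*, Ch. 3 Thm. 25): if
`(d_K/p) = 1` for every listed prime `p` (`d_K ≡ 1 (mod 8)` for `p = 2`), every prime of `l.prod` splits in `K`
(`satisfiesHeegnerHypothesis_mul_iff`, `satisfiesHeegnerHypothesis_one`). Used by the row files (parts 35a–35e) to DERIVE the
Heegner-hypothesis binders of the rows in the kernel (GEN 34 edit 3; moved here GEN 35). [cite: Marcus1977, Ch. 3 Thm. 25] [cite: Darmon2004, Hypothesis 3.9] -/
theorem satisfiesHeegnerHypothesis_listProd_of_kronecker {K : Type*} [Field K] [NumberField K]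
    (h2 : Module.finrank ℚ K = 2) {D : ℤ} (hD : NumberField.discr K = D) (l : List ℕ)
    (hl : ∀ p ∈ l, p.Prime ∧ (p = 2 → D % 8 = 1) ∧ (p ≠ 2 → jacobiSym D p = 1)) :
    SatisfiesHeegnerHypothesis l.prod K := by
  induction l with
  | nil => rw [List.prod_nil]; exact satisfiesHeegnerHypothesis_one K
  | cons q l ih =>
    rw [List.prod_cons, satisfiesHeegnerHypothesis_mul_iff]
    refine ⟨?_, ih fun p hp => hl p (List.mem_cons.mpr (Or.inr hp))⟩
    obtain ⟨hq, hvq⟩ := hl q (List.mem_cons.mpr (Or.inl rfl))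
    rw [satisfiesHeegnerHypothesis_iff_kronecker _ K h2, hD]
    intro p hp hpq
    obtain rfl := (Nat.prime_dvd_prime_iff_eq hp hq).mp hpq
    exact hvq

/-- **`d_K = -551` ⇒ every prime of `240930 = 2·3²·5·2677` splits in `K`** (KERNEL: Jacobi symbols
`(d_K/p) = 1` by `norm_num`, `d_K ≡ 1 (mod 8)` at `p = 2`; the decomposition law `satisfiesHeegnerHypothesis_listProd_of_kronecker`).
With Carayol `N = 240930`, `N' = 26770` and `SatisfiesHeegnerHypothesis.of_dvd` (`26770 ∣ 240930`, `3 ∣ 240930`) it DERIVES the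
former binders `hH`, `hH'`, `h3K` of the row. [cite: Marcus1977, Ch. 3 Thm. 25] [cite: Darmon2004, Hypothesis 3.9] -/
theorem satisfiesHeegnerHypothesis_240930_of_discr {K : Type*} [Field K] [NumberField K]
    (h2 : Module.finrank ℚ K = 2) (hD : NumberField.discr K = -551) : SatisfiesHeegnerHypothesis 240930 K := by
  have h := satisfiesHeegnerHypothesis_listProd_of_kronecker h2 hD [2, 3, 3, 5, 2677] (by
    intro p hp
    simp only [List.mem_cons, List.not_mem_nil, or_false] at hp
    rcases hp with rfl | rfl | rfl | rfl | rfl <;> norm_num)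
  norm_num [List.prod_cons, List.prod_nil] at h
  exact h

/-- **`d_K = -356` ⇒ every prime of `149895 = 3²·5·3331` splits in `K`** (KERNEL: Jacobi symbols
`(d_K/p) = 1` by `norm_num`; the decomposition law `satisfiesHeegnerHypothesis_listProd_of_kronecker`).
With Carayol `N = 149895`, `N' = 16655` and `SatisfiesHeegnerHypothesis.of_dvd` (`16655 ∣ 149895`, `3 ∣ 149895`) it DERIVES the
former binders `hH`, `hH'`, `h3K` of the row. [cite: Marcus1977, Ch. 3 Thm. 25] [cite: Darmon2004, Hypothesis 3.9] -/
theorem satisfiesHeegnerHypothesis_149895_of_discr {K : Type*} [Field K] [NumberField K]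
    (h2 : Module.finrank ℚ K = 2) (hD : NumberField.discr K = -356) : SatisfiesHeegnerHypothesis 149895 K := by
  have h := satisfiesHeegnerHypothesis_listProd_of_kronecker h2 hD [3, 3, 5, 3331] (by
    intro p hp
    simp only [List.mem_cons, List.not_mem_nil, or_false] at hp
    rcases hp with rfl | rfl | rfl | rfl <;> norm_num)
  norm_num [List.prod_cons, List.prod_nil] at h
  exact h

/-- **`d_K = -344` ⇒ every prime of `430425 = 3²·5²·1913` splits in `K`** (KERNEL: Jacobi symbols
`(d_K/p) = 1` by `norm_num`; the decomposition law `satisfiesHeegnerHypothesis_listProd_of_kronecker`).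
With Carayol `N = 430425`, `N' = 47825` and `SatisfiesHeegnerHypothesis.of_dvd` (`47825 ∣ 430425`, `3 ∣ 430425`) it DERIVES the
former binders `hH`, `hH'`, `h3K` of the row. [cite: Marcus1977, Ch. 3 Thm. 25] [cite: Darmon2004, Hypothesis 3.9] -/
theorem satisfiesHeegnerHypothesis_430425_of_discr {K : Type*} [Field K] [NumberField K]
    (h2 : Module.finrank ℚ K = 2) (hD : NumberField.discr K = -344) : SatisfiesHeegnerHypothesis 430425 K := by
  have h := satisfiesHeegnerHypothesis_listProd_of_kronecker h2 hD [3, 3, 5, 5, 1913] (by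
    intro p hp
    simp only [List.mem_cons, List.not_mem_nil, or_false] at hp
    rcases hp with rfl | rfl | rfl | rfl | rfl <;> norm_num)
  norm_num [List.prod_cons, List.prod_nil] at h
  exact h

/-- **`d_K = -263` ⇒ every prime of `439569 = 3²·13²·17²` splits in `K`** (KERNEL: Jacobi symbols
`(d_K/p) = 1` by `norm_num`; the decomposition law `satisfiesHeegnerHypothesis_listProd_of_kronecker`).
With Carayol `N = 439569`, `N' = 48841` and `SatisfiesHeegnerHypothesis.of_dvd` (`48841 ∣ 439569`, `3 ∣ 439569`) it DERIVES the
former binders `hH`, `hH'`, `h3K` of the row. [cite: Marcus1977, Ch. 3 Thm. 25] [cite: Darmon2004, Hypothesis 3.9] -/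
theorem satisfiesHeegnerHypothesis_439569_of_discr {K : Type*} [Field K] [NumberField K]
    (h2 : Module.finrank ℚ K = 2) (hD : NumberField.discr K = -263) : SatisfiesHeegnerHypothesis 439569 K := by
  have h := satisfiesHeegnerHypothesis_listProd_of_kronecker h2 hD [3, 3, 13, 13, 17, 17] (by
    intro p hp
    simp only [List.mem_cons, List.not_mem_nil, or_false] at hp
    rcases hp with rfl | rfl | rfl | rfl | rfl | rfl <;> norm_num)
  norm_num [List.prod_cons, List.prod_nil] at h
  exact h

/-- **`d_K = -551` ⇒ every prime of `23184 = 2⁴·3²·7·23` splits in `K`** (KERNEL: Jacobi symbols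
`(d_K/p) = 1` by `norm_num`, `d_K ≡ 1 (mod 8)` at `p = 2`; the decomposition law `satisfiesHeegnerHypothesis_listProd_of_kronecker`).
With Carayol `N = 23184`, `N' = 2576` and `SatisfiesHeegnerHypothesis.of_dvd` (`2576 ∣ 23184`, `3 ∣ 23184`) it DERIVES the
former binders `hH`, `hH'`, `h3K` of the row. [cite: Marcus1977, Ch. 3 Thm. 25] [cite: Darmon2004, Hypothesis 3.9] -/
theorem satisfiesHeegnerHypothesis_23184_of_discr {K : Type*} [Field K] [NumberField K]
    (h2 : Module.finrank ℚ K = 2) (hD : NumberField.discr K = -551) : SatisfiesHeegnerHypothesis 23184 K := by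
  have h := satisfiesHeegnerHypothesis_listProd_of_kronecker h2 hD [2, 2, 2, 2, 3, 3, 7, 23] (by
    intro p hp
    simp only [List.mem_cons, List.not_mem_nil, or_false] at hp
    rcases hp with rfl | rfl | rfl | rfl | rfl | rfl | rfl | rfl <;> norm_num)
  norm_num [List.prod_cons, List.prod_nil] at h
  exact h

/-- **`d_K = -551` ⇒ every prime of `162288 = 2⁴·3²·7²·23` splits in `K`** (KERNEL: Jacobi symbols
`(d_K/p) = 1` by `norm_num`, `d_K ≡ 1 (mod 8)` at `p = 2`; the decomposition law `satisfiesHeegnerHypothesis_listProd_of_kronecker`).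
With Carayol `N = 162288`, `N' = 2576` and `SatisfiesHeegnerHypothesis.of_dvd` (`2576 ∣ 162288`, `3 ∣ 162288`) it DERIVES the
former binders `hH`, `hH'`, `h3K` of the row. [cite: Marcus1977, Ch. 3 Thm. 25] [cite: Darmon2004, Hypothesis 3.9] -/
theorem satisfiesHeegnerHypothesis_162288_of_discr {K : Type*} [Field K] [NumberField K]
    (h2 : Module.finrank ℚ K = 2) (hD : NumberField.discr K = -551) : SatisfiesHeegnerHypothesis 162288 K := by
  have h := satisfiesHeegnerHypothesis_listProd_of_kronecker h2 hD [2, 2, 2, 2, 3, 3, 7, 7, 23] (by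
    intro p hp
    simp only [List.mem_cons, List.not_mem_nil, or_false] at hp
    rcases hp with rfl | rfl | rfl | rfl | rfl | rfl | rfl | rfl | rfl <;> norm_num)
  norm_num [List.prod_cons, List.prod_nil] at h
  exact h

end Summit.BirchSwinnertonDyer.Rank1Residual.O5.HeegnerLogTransport
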